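import Mathlib
import HarnessLib
import Literature.NumberTheory.GaloisRepresentations.RestrictedRamification
import Literature.NumberTheory.Automorphic.POrdinaryHeckeAlgebraGL2
import Summits.Langlands.Langlands.Theorems.EisensteinGelfandKirillovProModularOfGKBoundTwoLeafFernDefs
import Summits.Langlands.Langlands.Theorems.EisensteinGelfandKirillovProModularOfGKBoundStubNoetherianCompactRing

/-!
# Route `EisensteinGelfandKirillov`, crux `ProModularOfGKBound` (stmt-Langlands-18273), line
# `two-leaf-fern`: the determinant of a host and the Noetherian transfer
# (infrastructure for `stub_noetherianOf`, part 2 of 3)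

Continuation of `…StubNoetherianCompactRing.lean`.  The universal property of Chenevier's deformation
ring [cite: Chenevier2014, §3.1 Prop. 3.3] is stated for `2`-dimensional DETERMINANTS (the tree's
trace–determinant pairs `PseudoRep2`), while a host `ℋ : Host p O ρ ρ₀` carries a `2`-dimensional Taylor
PSEUDOCHARACTER `ℋ.T : Γ_F → ℋ.R`.  This file bridges the two and collects the consequences for hosts:

* §1 TWO-DIMENSIONAL PSEUDOCHARACTERS ARE CHENEVIER DETERMINANTS when `2` is invertible
  [cite: Chenevier2014, §1.2 Lemma 1.9; §1.6 Proposition (i) (d = 2, 2 invertible)]: from `S₃(T) = 0` alone,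
  `2 T(xy) + (T(y)² − T(y²)) T(xy⁻¹) = 2 T(x) T(y)` (`two_mul_map_mul_add`) and the multiplicativity
  `2 (T(xy)² − T((xy)²)) = (T(x)² − T(x²)) (T(y)² − T(y²))` (`two_mul_detAux_mul`); hence the character
  `det₂ = (T² − T ∘ sq)/2 : G →* A` and the trace–determinant pair `toPseudoRep2 : PseudoRep2 G A`,
  continuous when `T` is;
* §2 hosts: `𝔪_R` open, residue field finite of characteristic `p`, `p^n → 0`, `T` kills the
  ramification subgroup outside `badSet p ρ` and DESCENDS to `G_{F,S}` (`Host.TS`), the residual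
  pseudocharacter `T̄` has open kernel of finite index, the host's determinant `Host.D : PseudoRep2 Γ_F R`
  (continuous, unramified outside `badSet p ρ`, with `x ∘ det = σ ∘ det ρ` at every continuous point by
  (D)), and the SURJECTIVITY CRITERION: a continuous ring map from a compact ring whose range contains
  `T(Γ_F)` is onto (`Host.surjective_of_forall_mem_range`), so `ℋ.R` is Noetherian as soon as it is so
  covered by a compact Noetherian ring (`Host.isNoetherianRing_of_cover`, the registered sub-goal
  `stub_noetherianAux2`) — the last step of the proof of `stub_noetherianOf` in part 3.
-/

set_option linter.dupNamespace false
set_option autoImplicit false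

noncomputable section

open scoped NumberField Matrix Topology
open Filter Field IsDedekindDomain
open Literature.NumberTheory.GaloisRepresentations Literature.NumberTheory.Automorphic
open Literature.NumberTheory.Automorphic.BigHeckeGLn

namespace Summit.Langlands.Langlands.Cruxes.ProModularOfGKBound.TwoLeafFern

/-! ## 1. Two-dimensional pseudocharacters are Chenevier determinants (`2` invertible) -/

section Det2

variable {G : Type*} [Group G] {A : Type*} [CommRing A] {T : G → A}

/-- The `2`-dimensional pseudocharacter identity `S₃(T)(a, b, c) = 0`, written out.
[cite: Taylor1991, §1] [cite: Chenevier2014, §1.2 (the relation displayed after Lemma 1.9)] -/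
theorem frobenius_three_apply (hT : IsPseudocharacter T 2) (a b c : G) :
    T a * T b * T c - T (a * b) * T c - T (a * c) * T b - T (b * c) * T a + T (a * b * c)
      + T (a * c * b) = 0 := by
  have h := hT.frobenius ![a, b, c]
  rw [frobeniusS_three] at h
  simpa using h

/-- **Chenevier's identity (b) of Lemma 1.9 for a `2`-dimensional pseudocharacter**, cleared of the
denominator `2`: `2 T(xy) + (T(y)² − T(y²)) T(xy⁻¹) = 2 T(x) T(y)` — the pseudocharacter identity at
`(xy⁻¹, y, y)`. [cite: Chenevier2014, §1.2 Lemma 1.9] -/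
theorem two_mul_map_mul_add (hT : IsPseudocharacter T 2) (x y : G) :
    2 * T (x * y) + (T y ^ 2 - T (y * y)) * T (x * y⁻¹) = 2 * (T x * T y) := by
  have h := frobenius_three_apply hT (x * y⁻¹) y y
  simp only [inv_mul_cancel_right] at h
  linear_combination h

/-- **Multiplicativity of `T(x)² − T(x²)` up to the factor `2`** ("the non-trivial part" of
[Chenevier2014, §1.6 Proposition (i): d = 2 and 2 invertible], here for group elements): `2 (T(xy)² − T((xy)²)) =
(T(x)² − T(x²)) (T(y)² − T(y²))`, a linear combination of the pseudocharacter identity at `(x, y, xy)`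
and of `two_mul_map_mul_add` at `(xy, y)` and `(x·xy, y)`.
[cite: Chenevier2014, §1.6 Proposition (i) (pseudocharacters = determinants for d = 2, 2 ∈ A⁎)] -/
theorem two_mul_detAux_mul (hT : IsPseudocharacter T 2) (x y : G) :
    2 * (T (x * y) ^ 2 - T (x * y * (x * y))) = (T x ^ 2 - T (x * x)) * (T y ^ 2 - T (y * y)) := by
  have hstar := frobenius_three_apply hT x y (x * y)
  have hii := two_mul_map_mul_add hT (x * y) y
  rw [mul_inv_cancel_right] at hii
  have hiii := two_mul_map_mul_add hT (x * (x * y)) y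
  rw [show x * (x * y) * y⁻¹ = x * x by group] at hiii
  have hc1 : T (x * y * y) = T (y * (x * y)) := hT.map_mul_comm _ _
  rw [hc1] at hii
  linear_combination (-2) * hstar + hiii - (T x) * hii

variable (T)

/-- **The determinant character of a `2`-dimensional pseudocharacter** when `2` is invertible
(`u · 2 = 1`): `det₂(g) = (T(g)² − T(g²))/2`, a group homomorphism `G →* A`.
[cite: Chenevier2014, §1.6 Proposition (i) (pseudocharacters = determinants for d = 2, 2 ∈ A⁎)] -/
def det₂ (hT : IsPseudocharacter T 2) (u : A) (hu : u * 2 = 1) : G →* A where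
  toFun g := u * (T g ^ 2 - T (g * g))
  map_one' := by
    simp only [mul_one, hT.map_one, Nat.cast_ofNat]
    linear_combination hu
  map_mul' x y := by
    have h := two_mul_detAux_mul hT x y
    linear_combination (u ^ 2) * h - (u * (T (x * y) ^ 2 - T (x * y * (x * y)))) * hu

/-- Unfolding lemma for `det₂`. [folklore] -/
@[simp] theorem det₂_apply (hT : IsPseudocharacter T 2) (u : A) (hu : u * 2 = 1) (g : G) :
    det₂ T hT u hu g = u * (T g ^ 2 - T (g * g)) := rfl

/-- `2 det₂(g) = T(g)² − T(g²)` (Cayley–Hamilton for the trace). [cite: Chenevier2014, §1.2] -/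
theorem two_mul_det₂ (hT : IsPseudocharacter T 2) (u : A) (hu : u * 2 = 1) (g : G) :
    2 * det₂ T hT u hu g = T g ^ 2 - T (g * g) := by
  rw [det₂_apply]
  linear_combination (T g ^ 2 - T (g * g)) * hu

/-- **A `2`-dimensional (Taylor) pseudocharacter with `2` invertible is a `2`-dimensional Chenevier
determinant** in the tree's trace–determinant form `PseudoRep2` (`trace = T`, `det = det₂`): Chenevier's
identity `D(g) T(g⁻¹h) − T(g) T(h) + T(gh) = 0` is `two_mul_map_mul_add` at `(h, g)` and centrality.
[cite: Chenevier2014, §1.2 Lemma 1.9; §1.6 Proposition (i)] -/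
def toPseudoRep2 (hT : IsPseudocharacter T 2) (u : A) (hu : u * 2 = 1) : PseudoRep2 G A where
  trace := T
  det := (det₂ T hT u hu).toHomUnits
  trace_one := by rw [hT.map_one]; norm_num
  trace_mul_comm := hT.map_mul_comm
  det_mul_trace_inv_mul g h := by
    have hA := two_mul_map_mul_add hT h g
    rw [hT.map_mul_comm h g, hT.map_mul_comm h g⁻¹] at hA
    show u * (T g ^ 2 - T (g * g)) * T (g⁻¹ * h) - T g * T h + T (g * h) = 0
    linear_combination u * hA - (T (g * h) - T g * T h) * hu

/-- Unfolding lemma: the trace of `toPseudoRep2` is `T`. [folklore] -/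
@[simp] theorem toPseudoRep2_trace (hT : IsPseudocharacter T 2) (u : A) (hu : u * 2 = 1) :
    (toPseudoRep2 T hT u hu).trace = T := rfl

/-- Unfolding lemma: the determinant of `toPseudoRep2` is `det₂`. [folklore] -/
@[simp] theorem toPseudoRep2_det (hT : IsPseudocharacter T 2) (u : A) (hu : u * 2 = 1) (g : G) :
    ((toPseudoRep2 T hT u hu).det g : A) = u * (T g ^ 2 - T (g * g)) := rfl

variable {T}

/-- `toPseudoRep2` of a CONTINUOUS pseudocharacter is a continuous determinant (`PseudoRep2.IsContinuous`:
trace and determinant continuous). [cite: Chenevier2014, §2.5] -/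
theorem isContinuous_toPseudoRep2 [TopologicalSpace G] [ContinuousMul G] [TopologicalSpace A]
    [IsTopologicalRing A] (T : ContinuousPseudocharacter G A 2) (u : A) (hu : u * 2 = 1) :
    (toPseudoRep2 (T : G → A) T.isPseudocharacter u hu).IsContinuous where
  continuous_trace := T.continuous
  continuous_det := by
    show Continuous fun g => u * (T g ^ 2 - T (g * g))
    fun_prop

/-- An element of Taylor's kernel has trivial determinant: `T(hg) = T(g)` for all `g` forces
`T(h) = T(h²) = 2`, so `det₂(h) = (4 − 2)/2 = 1`. [cite: Chenevier2014, §1.4] -/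
theorem det₂_eq_one_of_forall (hT : IsPseudocharacter T 2) (u : A) (hu : u * 2 = 1) {h : G}
    (hh : ∀ g, T (g * h) = T g) : det₂ T hT u hu h = 1 := by
  have h1 : T h = 2 := by rw [← one_mul h, hh 1, hT.map_one]; norm_num
  have h2 : T (h * h) = 2 := by rw [hh h, h1]
  rw [det₂_apply, h1, h2]
  linear_combination hu

end Det2

/-! ## 2. Consequences for hosts -/

namespace Host

variable {F : Type} [Field F] [NumberField F] {p : ℕ} [Fact p.Prime]
  {O : ValuationSubring (PadicAlgCl p)} {ρ : FramedGaloisRep F (PadicAlgCl p) 2}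
  {ρ₀ : absoluteGaloisGroup F →* GL (Fin 2) O}

/-- The maximal ideal of a host is open. [folklore] -/
theorem isOpen_maximalIdeal (ℋ : Host p O ρ ρ₀) :
    IsOpen ((IsLocalRing.maximalIdeal ℋ.R : Ideal ℋ.R) : Set ℋ.R) :=
  isOpen_maximalIdeal_of_compact

/-- The residue field `k = R/𝔪_R` of a host is finite … [folklore] -/
theorem finite_residueField (ℋ : Host p O ρ ρ₀) : Finite (IsLocalRing.ResidueField ℋ.R) :=
  finite_residueField_of_compact

/-- … of characteristic `p`. [folklore] -/
theorem charP_residueField (ℋ : Host p O ρ ρ₀) : CharP (IsLocalRing.ResidueField ℋ.R) p :=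
  charP_residueField_of_mem_maximalIdeal ℋ.mem_maximalIdeal

/-- `p` is topologically nilpotent in a host: `p^n → 0`. [folklore] -/
theorem tendsto_prime_pow (ℋ : Host p O ρ ρ₀) :
    Tendsto (fun n : ℕ => ((p : ℕ) : ℋ.R) ^ n) atTop (𝓝 0) :=
  tendsto_natCast_pow_of_mem_maximalIdeal ℋ.mem_maximalIdeal

/-- **(U0) in group form: Taylor's kernel of `T` contains the ramification subgroup `N_S` outside
`S = badSet p ρ`** (the closed normal subgroup generated by the inertia groups above `v ∉ S`), because the
kernel is a closed normal subgroup containing those inertia groups (`Host.unramified`).  Hence `T` is a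
pseudocharacter of `G_{F,S} = Γ_F ⧸ N_S` (`Host.TS`). [cite: NeukirchSchmidtWingberg2008, VIII §3] -/
theorem ramificationSubgroup_le_ker (ℋ : Host p O ρ ρ₀) :
    ramificationSubgroup F (badSet p ρ) ≤ ℋ.T.ker := by
  refine Subgroup.topologicalClosure_minimal _ ?_ ℋ.T.isClosed_ker
  refine Subgroup.normalClosure_le_normal fun σ hσ => ?_
  rw [mem_inertiaOutside_iff] at hσ
  obtain ⟨v, hv, 𝔓, h𝔓, hσ⟩ := hσ
  exact ContinuousPseudocharacter.mem_ker.2 (ℋ.unramified v hv 𝔓 h𝔓 σ hσ)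

/-- **The universal pseudocharacter of a host as a continuous pseudocharacter of `G_{F,S}`**,
`S = badSet p ρ` (descent through `Γ_F ↠ G_{F,S}`); this is the object classified by the universal
pseudo-deformation ring of `T̄` on `G_{F,S}`. [cite: Chenevier2014, §3.1] -/
def TS (ℋ : Host p O ρ ρ₀) :
    ContinuousPseudocharacter (GaloisGroupUnramifiedOutside F (badSet p ρ)) ℋ.R 2 :=
  pseudocharacterDescend ℋ.T (ramificationSubgroup F (badSet p ρ)) ℋ.ramificationSubgroup_le_ker

/-- `TS ∘ (Γ_F ↠ G_{F,S}) = T`. [folklore] -/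
@[simp] theorem TS_mk (ℋ : Host p O ρ ρ₀) (g : absoluteGaloisGroup F) :
    ℋ.TS (toUnramifiedQuot F (badSet p ρ) g) = ℋ.T g := rfl

/-- The values of `TS` are the values of `T` (same range, so they too topologically generate `R`).
[folklore] -/
theorem range_TS (ℋ : Host p O ρ ρ₀) :
    Set.range (ℋ.TS : GaloisGroupUnramifiedOutside F (badSet p ρ) → ℋ.R) =
      Set.range (ℋ.T : absoluteGaloisGroup F → ℋ.R) := by
  ext r
  constructor
  · rintro ⟨q, rfl⟩
    obtain ⟨g, rfl⟩ := QuotientGroup.mk_surjective q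
    exact ⟨g, rfl⟩
  · rintro ⟨g, rfl⟩
    exact ⟨toUnramifiedQuot F (badSet p ρ) g, rfl⟩

/-- **The residual pseudocharacter** `T̄ = T mod 𝔪_R : Γ_F → k`, a continuous `2`-dimensional
pseudocharacter with values in the finite residue ring `R ⧸ 𝔪_R` (quotient topology, discrete).
[cite: Chenevier2014, §3.1] -/
def residual (ℋ : Host p O ρ ρ₀) :
    ContinuousPseudocharacter (absoluteGaloisGroup F) (ℋ.R ⧸ IsLocalRing.maximalIdeal ℋ.R) 2 :=
  ℋ.T.map (Ideal.Quotient.mk (IsLocalRing.maximalIdeal ℋ.R)) continuous_mk_maximalIdeal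

/-- `T̄ g = T g mod 𝔪_R`. [folklore] -/
@[simp] theorem residual_apply (ℋ : Host p O ρ ρ₀) (g : absoluteGaloisGroup F) :
    ℋ.residual g = Ideal.Quotient.mk (IsLocalRing.maximalIdeal ℋ.R) (ℋ.T g) := rfl

/-- Taylor's kernel of the residual pseudocharacter of a host is OPEN in `Γ_F` (discrete finite
coefficients, compact group). [folklore] -/
theorem isOpen_ker_residual (ℋ : Host p O ρ ρ₀) :
    IsOpen ((ℋ.residual.ker : Subgroup (absoluteGaloisGroup F)) : Set (absoluteGaloisGroup F)) := by
  haveI : DiscreteTopology (ℋ.R ⧸ IsLocalRing.maximalIdeal ℋ.R) :=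
    discreteTopology_quotient_maximalIdeal_of_compact
  exact isOpen_ker_of_discreteTopology ℋ.residual

/-- … so `T̄` factors through a finite quotient of `Γ_F`. [folklore] -/
theorem finite_quotient_ker_residual (ℋ : Host p O ρ ρ₀) :
    Finite (absoluteGaloisGroup F ⧸ ℋ.residual.ker) := by
  haveI : DiscreteTopology (ℋ.R ⧸ IsLocalRing.maximalIdeal ℋ.R) :=
    discreteTopology_quotient_maximalIdeal_of_compact
  exact finite_quotient_ker_of_discreteTopology ℋ.residual

/-- Taylor's kernel of `T` lies in that of `T̄`; in particular the residual kernel also contains the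
ramification subgroup outside `badSet p ρ`. [folklore] -/
theorem ker_le_ker_residual (ℋ : Host p O ρ ρ₀) : ℋ.T.ker ≤ ℋ.residual.ker := by
  intro h hh
  rw [ContinuousPseudocharacter.mem_ker] at hh ⊢
  intro g
  rw [residual_apply, residual_apply, hh g]

/-- A chosen inverse of `2` in a host (`p ≥ 3`, so `2 ∈ Rˣ` by `Host.isUnit_two`). [folklore] -/
def halfOf (ℋ : Host p O ρ ρ₀) (hp : 3 ≤ p) : ℋ.R := ((ℋ.isUnit_two hp).unit⁻¹ : (ℋ.R)ˣ)

/-- `halfOf · 2 = 1`. [folklore] -/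
theorem halfOf_mul_two (ℋ : Host p O ρ ρ₀) (hp : 3 ≤ p) : ℋ.halfOf hp * 2 = 1 := by
  rw [halfOf]
  exact (ℋ.isUnit_two hp).unit.inv_mul

/-- **The host's universal pseudocharacter as a `2`-dimensional Chenevier determinant**
`D = (T, det₂) : Γ_F → R` (`PseudoRep2`, the vocabulary of the tree's determinant deformation problems,
e.g. `OrdinaryDeterminantDatum`). [cite: Chenevier2014, §1.2 Lemma 1.9; §1.6 Proposition (i)] -/
def D (ℋ : Host p O ρ ρ₀) (hp : 3 ≤ p) : PseudoRep2 (absoluteGaloisGroup F) ℋ.R :=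
  toPseudoRep2 (ℋ.T : absoluteGaloisGroup F → ℋ.R) ℋ.T.isPseudocharacter (ℋ.halfOf hp)
    (ℋ.halfOf_mul_two hp)

/-- The trace of `ℋ.D` is `ℋ.T`. [folklore] -/
@[simp] theorem D_trace (ℋ : Host p O ρ ρ₀) (hp : 3 ≤ p) (g : absoluteGaloisGroup F) :
    (ℋ.D hp).trace g = ℋ.T g := rfl

/-- `2 · det D(g) = T(g)² − T(g²)`. [cite: Chenevier2014, §1.2] -/
theorem two_mul_D_det (ℋ : Host p O ρ ρ₀) (hp : 3 ≤ p) (g : absoluteGaloisGroup F) :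
    2 * ((ℋ.D hp).det g : ℋ.R) = ℋ.T g ^ 2 - ℋ.T (g * g) :=
  two_mul_det₂ _ ℋ.T.isPseudocharacter _ (ℋ.halfOf_mul_two hp) g

/-- `ℋ.D` is a continuous determinant. [cite: Chenevier2014, §2.5] -/
theorem D_isContinuous (ℋ : Host p O ρ ρ₀) (hp : 3 ≤ p) : (ℋ.D hp).IsContinuous :=
  isContinuous_toPseudoRep2 ℋ.T _ (ℋ.halfOf_mul_two hp)

/-- **(U0) for the determinant**: `ℋ.D` is unramified outside `badSet p ρ` in the sense of
`PseudoRep2.IsUnramifiedAt` (inertia acts trivially on the trace, by centrality on either side, and has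
determinant `1`). [cite: Chenevier2014, §1.4] -/
theorem D_isUnramifiedAt (ℋ : Host p O ρ ρ₀) (hp : 3 ≤ p) {v : HeightOneSpectrum (𝓞 F)}
    (hv : v ∉ badSet p ρ) : (ℋ.D hp).IsUnramifiedAt v := by
  intro 𝔓 h𝔓 σ hσ
  have hker : ∀ g, ℋ.T (g * σ) = ℋ.T g := ℋ.unramified v hv 𝔓 h𝔓 σ hσ
  refine ⟨fun g => ?_, Units.ext ?_⟩
  · show ℋ.T (σ * g) = ℋ.T g
    rw [ℋ.T.map_mul_comm, hker]
  · exact det₂_eq_one_of_forall ℋ.T.isPseudocharacter _ (ℋ.halfOf_mul_two hp) hker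

/-- **(D) for the determinant**: at every continuous point `x : R → ℚ̄_p` the determinant character of
`ℋ.D` specialises to `σ ∘ det ρ` for some `σ ∈ Gal(ℚ̄_p/ℚ_p)` (from `Host.det_point`, dividing by `2`).
[folklore] -/
theorem point_D_det (ℋ : Host p O ρ ρ₀) (hp : 3 ≤ p) (x : ℋ.R →+* PadicAlgCl p) (hx : Continuous x) :
    ∃ σ : PadicAlgCl p ≃ₐ[ℚ_[p]] PadicAlgCl p, ∀ g,
      x ((ℋ.D hp).det g : ℋ.R) =
        σ ((ρ g : GL (Fin 2) (PadicAlgCl p)) : Matrix (Fin 2) (Fin 2) (PadicAlgCl p)).det := by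
  obtain ⟨σ, hσ⟩ := ℋ.det_point x hx
  refine ⟨σ, fun g => ?_⟩
  have h2 : x (ℋ.halfOf hp) * 2 = 1 := by
    have := congrArg x (ℋ.halfOf_mul_two hp)
    rwa [map_mul, map_ofNat, map_one] at this
  have hdef : ((ℋ.D hp).det g : ℋ.R) = ℋ.halfOf hp * (ℋ.T g ^ 2 - ℋ.T (g * g)) := rfl
  rw [hdef, map_mul, map_sub, map_pow, hσ g]
  linear_combination
    (σ ((ρ g : GL (Fin 2) (PadicAlgCl p)) : Matrix (Fin 2) (Fin 2) (PadicAlgCl p)).det) * h2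

/-- **(G) as a surjectivity criterion.**  A closed subring of `ℋ.R` containing all the `T g` is
everything. [folklore] -/
theorem subring_eq_top (ℋ : Host p O ρ ρ₀) (B : Subring ℋ.R) (hB : IsClosed (B : Set ℋ.R))
    (hT : ∀ g, ℋ.T g ∈ B) : B = ⊤ := by
  have h1 : Subring.closure (Set.range (ℋ.T : absoluteGaloisGroup F → ℋ.R)) ≤ B :=
    Subring.closure_le.2 (by rintro _ ⟨g, rfl⟩; exact hT g)
  have h2 : (Subring.closure (Set.range (ℋ.T : absoluteGaloisGroup F → ℋ.R))).topologicalClosure ≤ B :=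
    Subring.topologicalClosure_minimal _ h1 hB
  rw [ℋ.traces_dense] at h2
  exact top_le_iff.1 h2

/-- **A continuous ring homomorphism from a compact ring into a host whose range contains `T(Γ_F)` is
surjective** (its range is a closed subring containing the topological generators).  This is the last
step of the paper proof of `stub_noetherianOf`, applied there to the classifying map `R^{univ}_{T̄} → ℋ.R`
of Chenevier's universal pseudo-deformation ring. [cite: Chenevier2014, §3.1 Remark 3.5] -/
theorem surjective_of_forall_mem_range (ℋ : Host p O ρ ρ₀) {A : Type*} [CommRing A]
    [TopologicalSpace A] [CompactSpace A] (f : A →+* ℋ.R) (hf : Continuous f)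
    (hT : ∀ g, ℋ.T g ∈ Set.range f) : Function.Surjective f := by
  have hc : IsClosed ((f.range : Subring ℋ.R) : Set ℋ.R) := by
    rw [RingHom.coe_range]
    exact (isCompact_range hf).isClosed
  have htop := ℋ.subring_eq_top f.range hc fun g => by
    obtain ⟨a, ha⟩ := hT g
    exact ⟨a, ha⟩
  intro r
  have hr : r ∈ f.range := htop ▸ Subring.mem_top r
  exact hr

/-- **Noetherian transfer**: a host covered, in the sense of `surjective_of_forall_mem_range`, by a
compact NOETHERIAN ring is Noetherian (quotients of Noetherian rings are Noetherian).  With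
`A = R^{univ}_{T̄}` (Noetherian by `Φ_p` for `G_{F,S}`) this is `stub_noetherianOf`.
[cite: Chenevier2014, §3.1 Prop. 3.3 and the Proposition on condition (F)] -/
theorem isNoetherianRing_of_cover (ℋ : Host p O ρ ρ₀) {A : Type*} [CommRing A]
    [TopologicalSpace A] [CompactSpace A] [IsNoetherianRing A] (f : A →+* ℋ.R) (hf : Continuous f)
    (hT : ∀ g, ℋ.T g ∈ Set.range f) : IsNoetherianRing ℋ.R :=
  isNoetherianRing_of_surjective A ℋ.R f (ℋ.surjective_of_forall_mem_range f hf hT)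

end Host

/-! ## Registered sub-goal -/

/-- **Sub-goal `stub_noetherianAux2` of `stub_noetherianOf` (Noetherian transfer)**: a host whose
coefficient ring receives a continuous ring homomorphism from a compact NOETHERIAN ring with every `T g`
in its range is Noetherian (the range is a closed subring containing the topological generators (G), so
the map is onto; `Host.isNoetherianRing_of_cover`). [cite: Chenevier2014, §3.1 Remark 3.5] -/
theorem stub_noetherianAux2 : ∀ (F : Type) [Field F] [NumberField F] (p : ℕ) [Fact p.Prime] (O : ValuationSubring (PadicAlgCl p)) (ρ : FramedGaloisRep F (PadicAlgCl p) 2) (ρ₀ : absoluteGaloisGroup F →* GL (Fin 2) O) (ℋ : Host p O ρ ρ₀) (A : Type) [CommRing A] [TopologicalSpace A] [CompactSpace A] [IsNoetherianRing A] (f : A →+* ℋ.R), Continuous f → (∀ g, ℋ.T g ∈ Set.range f) → IsNoetherianRing ℋ.R :=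
  fun _ _ _ _ _ _ _ _ ℋ _ _ _ _ _ f hf hT => ℋ.isNoetherianRing_of_cover f hf hT

end Summit.Langlands.Langlands.Cruxes.ProModularOfGKBound.TwoLeafFern

end
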